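import Mathlib
import Summits.ValiantsHypothesis.ValiantsHypothesis.Theorems.BarrierLeverPartitionMinorsHitByVPHiddenStatesCoHubAllLift
import Summits.ValiantsHypothesis.ValiantsHypothesis.Theorems.BarrierLeverPartitionMinorsHitByVPHiddenStatesCoHubCells

/-!
# Route BarrierLever — item `PartitionMinorsHitByVP` (stmt-ValiantsHypothesis-19717), line `hidden-states`:
# THE CO-HUB THEOREM FOR THE ALL-`u` NODE — the body of `Stmt.stub_universalJoinWide` at `(h, 2^h − c)` for EVERY `h` and EVERY
# `1 ≤ c ≤ 2h³ − 2h + 2`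

Helper file (`--supports stmt-ValiantsHypothesis-19717`; cell valiant-natproofs, rung V4, 𝒟-side door (c), registered line
`Cruxes/PartitionMinorsHitByVP/Lines/hidden_states.lean` v8; prover seat val-np-p6 gen 14). Definition-free; closes NO item.
Sequel of `…HiddenStatesCoHubAllLift` (`CoHub.coHub_lift_all`) and `…HiddenStatesCoHubCells` (the lower-node version).

Same construction as `CoHub.universalJoinWideLower_coHub` (two-star base at `n₀ = ⌊log₂ c⌋ + 1`, then `h − n₀` doubling lifts with two
fresh star pieces each), now for ARBITRARY injective row families: the registered ALL-`u` node `Stmt.stub_universalJoinWide` of the line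
(p569457's door, `b = 8`) holds at every cell `(h, 2^h − c)` with `1 ≤ c < 2^h`, `c + 2h ≤ 2h³ + 2`.

* `coHub_iter_all` — the all-`u` lift iterated.
* **`universalJoinWide_coHub`** — the all-`u` co-hub theorem.
* `universalJoinWide_coTop_poly` — the same stated by `r` (`2^h + 2h ≤ r + 2h³ + 2`), including the full cube.
* `allu_window_nineteen` — bookkeeping: at `h = 19` the ALL-`u` node is now open only on `289 561 ≤ r ≤ 510 605`
  (`HubWide.universalJoinWide_of_le_hub` below, the co-hub above; it was `289 561 ≤ r ≤ 524 284`).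

WHAT THIS IS NOT: the registered stub `stub_universalJoinWide` (`∃ h₁ ∀ h ≥ h₁ ∀ r ≤ 2^h`) is NOT closed — the bulk
`2h⁴ + O(h³) < r < 2^h − 2h³` remains; nothing on crux 14610 or VP ≠ VNP.
-/

set_option linter.dupNamespace false

namespace Summit.ValiantsHypothesis.ValiantsHypothesis.Theorems.BarrierLever.HiddenStates

open Finset Matrix MvPolynomial

noncomputable section

namespace CoHub

/-- **Iterated all-`u` co-hub lift** (`m ↦ m + 2d`, `K ↦ K + d`). -/
theorem coHub_iter_all (n₀ c m K : ℕ) (hn₀ : c < 2 ^ n₀) (hcK : c ≤ 2 * (K + 2))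
    (H : ∃ (W : Fin m → ℕ) (wt : Fin m → Fin K → ℕ) (e : Fin (2 ^ n₀ - c) → Fin m × Finset (Fin K)),
      Function.Injective e ∧
      (∀ x : Fin m × Finset (Fin K), x ∉ Set.range e →
        ∀ i, W (e i).1 + ∑ k ∈ (e i).2, wt (e i).1 k < W x.1 + ∑ k ∈ x.2, wt x.1 k) ∧
      ∀ u : Fin (2 ^ n₀ - c) → Finset (Fin n₀), Function.Injective u →
        ∃ tx : Fin m → Option (Fin K) → Fin n₀ → ℂ,
          (Matrix.of fun i k : Fin (2 ^ n₀ - c) =>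
            ∏ a ∈ u i, (tx (e k).1 none a + ∑ q ∈ (e k).2, tx (e k).1 (some q) a)).det ≠ 0) (d : ℕ) :
    ∃ (W : Fin (m + 2 * d) → ℕ) (wt : Fin (m + 2 * d) → Fin (K + d) → ℕ)
      (e : Fin (2 ^ (n₀ + d) - c) → Fin (m + 2 * d) × Finset (Fin (K + d))),
      Function.Injective e ∧
      (∀ x : Fin (m + 2 * d) × Finset (Fin (K + d)), x ∉ Set.range e →
        ∀ i, W (e i).1 + ∑ k ∈ (e i).2, wt (e i).1 k < W x.1 + ∑ k ∈ x.2, wt x.1 k) ∧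
      ∀ u : Fin (2 ^ (n₀ + d) - c) → Finset (Fin (n₀ + d)), Function.Injective u →
        ∃ tx : Fin (m + 2 * d) → Option (Fin (K + d)) → Fin (n₀ + d) → ℂ,
          (Matrix.of fun i k : Fin (2 ^ (n₀ + d) - c) =>
            ∏ a ∈ u i, (tx (e k).1 none a + ∑ q ∈ (e k).2, tx (e k).1 (some q) a)).det ≠ 0 := by
  induction d with
  | zero => simpa using H
  | succ d ih =>
    have hpow : 2 ^ n₀ ≤ 2 ^ (n₀ + d) := Nat.pow_le_pow_right (by norm_num) (by omega)
    have hr : 2 ^ (n₀ + (d + 1)) - c = (2 ^ (n₀ + d) - c) + (2 ^ (n₀ + d) - c) + c := by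
      rw [show n₀ + (d + 1) = (n₀ + d) + 1 by omega, pow_succ]; omega
    rw [hr, show m + 2 * (d + 1) = (m + 2 * d) + 2 by ring, show K + (d + 1) = (K + d) + 1 by ring,
      show n₀ + (d + 1) = (n₀ + d) + 1 by ring]
    exact coHub_lift_all (n₀ + d) c (m + 2 * d) (K + d) (2 ^ (n₀ + d) - c) 2 (by omega) (by omega) (by omega) ih

/-- **THE ALL-`u` CO-HUB THEOREM.** For every `h` and every `c` with `1 ≤ c < 2^h` and `c + 2h ≤ 2h³ + 2`, the body of the registered
node `Stmt.stub_universalJoinWide` holds at `(h, 2^h − c)`: ONE legal wide join design (`≤ 2h` pieces, `≤ h³` states) whose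
block-additive matrix is nonsingular at some table for EVERY injective row family `u : Fin (2^h − c) → Finset (Fin h)`. -/
theorem universalJoinWide_coHub (h c : ℕ) (hc1 : 1 ≤ c) (hch : c < 2 ^ h) (hcK : c + 2 * h ≤ 2 * (h * h * h) + 2) :
    ∃ (m K : ℕ) (W : Fin m → ℕ) (wt : Fin m → Fin K → ℕ) (e : Fin (2 ^ h - c) → Fin m × Finset (Fin K)),
      m ≤ h + h ∧ K ≤ h * h * h ∧ Function.Injective e ∧
      (∀ x : Fin m × Finset (Fin K), x ∉ Set.range e →
        ∀ i, W (e i).1 + ∑ k ∈ (e i).2, wt (e i).1 k < W x.1 + ∑ k ∈ x.2, wt x.1 k) ∧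
      ∀ u : Fin (2 ^ h - c) → Finset (Fin h), Function.Injective u →
        ∃ tx : Fin m → Option (Fin K) → Fin h → ℂ,
          (Matrix.of fun i k : Fin (2 ^ h - c) =>
            ∏ a ∈ u i, (tx (e k).1 none a + ∑ q ∈ (e k).2, tx (e k).1 (some q) a)).det ≠ 0 := by
  set n₀ : ℕ := Nat.log 2 c + 1 with hn₀def
  have hc0 : c ≠ 0 := by omega
  have hn₀c : c < 2 ^ n₀ := Nat.lt_pow_succ_log_self (by norm_num) c
  have hcn₀ : 2 ^ n₀ ≤ 2 * c := by
    rw [hn₀def, pow_succ]; have := Nat.pow_log_le_self 2 hc0; omega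
  have hn₀h : n₀ ≤ h := by
    have := Nat.log_lt_of_lt_pow hc0 hch; omega
  have hn₀1 : 1 ≤ n₀ := by omega
  have h1 : 1 ≤ h := le_trans hn₀1 hn₀h
  have hhh : h ≤ h * h * h := by
    calc h = h * 1 * 1 := by ring
      _ ≤ h * h * h := Nat.mul_le_mul (Nat.mul_le_mul le_rfl h1) h1
  obtain ⟨d, hd⟩ : ∃ d, h = n₀ + d := ⟨h - n₀, by omega⟩
  obtain ⟨W, wt, e, he, hthr, hgood⟩ :=
    StarJoin.starJoin_good n₀ 2 (h * h * h - h) (2 ^ n₀ - c) (by omega)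
  have Hiter := coHub_iter_all n₀ c 2 (h * h * h - h) hn₀c (by omega) ⟨W, wt, e, he, hthr, hgood⟩ d
  rw [← hd] at Hiter
  obtain ⟨W', wt', e', he', hthr', hgood'⟩ := Hiter
  exact ⟨2 + 2 * d, h * h * h - h + d, W', wt', e', by omega, by omega, he', hthr', hgood'⟩

/-- **The all-`u` co-hub window stated by `r`.** For `h ≥ 2` and every `r ≤ 2^h` with `2^h + 2h ≤ r + 2h³ + 2` the body of
`Stmt.stub_universalJoinWide` holds at `(h, r)` (the full cube by `FlagCells.universalJoinWide_full`, p622861). -/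
theorem universalJoinWide_coTop_poly (h r : ℕ) (h2 : 2 ≤ h) (hr : r ≤ 2 ^ h)
    (hwin : 2 ^ h + 2 * h ≤ r + 2 * (h * h * h) + 2) :
    ∃ (m K : ℕ) (W : Fin m → ℕ) (wt : Fin m → Fin K → ℕ) (e : Fin r → Fin m × Finset (Fin K)),
      m ≤ h + h ∧ K ≤ h * h * h ∧ Function.Injective e ∧
      (∀ x : Fin m × Finset (Fin K), x ∉ Set.range e →
        ∀ i, W (e i).1 + ∑ k ∈ (e i).2, wt (e i).1 k < W x.1 + ∑ k ∈ x.2, wt x.1 k) ∧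
      ∀ u : Fin r → Finset (Fin h), Function.Injective u →
        ∃ tx : Fin m → Option (Fin K) → Fin h → ℂ,
          (Matrix.of fun i k : Fin r =>
            ∏ a ∈ u i, (tx (e k).1 none a + ∑ q ∈ (e k).2, tx (e k).1 (some q) a)).det ≠ 0 := by
  by_cases htop : r = 2 ^ h
  · subst htop
    exact FlagCells.universalJoinWide_full h h2
  have hrc : r = 2 ^ h - (2 ^ h - r) := by omega
  have hhh : h ≤ h * h * h := by
    calc h = h * 1 * 1 := by ring
      _ ≤ h * h * h := Nat.mul_le_mul (Nat.mul_le_mul le_rfl (by omega)) (by omega)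
  by_cases hsmall : 2 ^ h - r < 2 ^ h
  · rw [hrc]
    exact universalJoinWide_coHub h (2 ^ h - r) (by omega) hsmall (by omega)
  · have hr0 : r = 0 := by
      have : 1 ≤ 2 ^ h := Nat.one_le_two_pow
      omega
    subst hr0
    refine ⟨0, 0, Fin.elim0, fun p => Fin.elim0 p, Fin.elim0, by omega, by omega, fun i => Fin.elim0 i, ?_, ?_⟩
    · rintro ⟨p, _⟩; exact Fin.elim0 p
    · intro u _
      exact ⟨fun p => Fin.elim0 p, by simp [Matrix.det_fin_zero]⟩

/-- Bookkeeping at `h = 19` for the ALL-`u` node: hub joins serve every `r ≤ 289 560` (`HubWide.hub_range_nineteen`), the co-hub every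
`r ≥ 2^19 − 13 682 = 510 606`; the open all-`u` window shrinks from `(289 560, 524 284]` to `289 561 ≤ r ≤ 510 605`. -/
theorem allu_window_nineteen :
    2 * (19 * 19 * 19) + 2 - 2 * 19 = 13682 ∧ 2 ^ 19 - 13682 = 510606 ∧
      (19 + 19) * (19 * 19 * 19 + 1) + 4 * (19 * 19 * 19) + 4 * (19 * 19) = 289560 := by
  norm_num

/-- **`h = 19`, all families: every `r ≥ 510 606`** (`r ≤ 2^19`). -/
theorem universalJoinWide_nineteen_coTop (r : ℕ) (hlo : 510606 ≤ r) (hr : r ≤ 2 ^ 19) :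
    ∃ (m K : ℕ) (W : Fin m → ℕ) (wt : Fin m → Fin K → ℕ) (e : Fin r → Fin m × Finset (Fin K)),
      m ≤ 19 + 19 ∧ K ≤ 19 * 19 * 19 ∧ Function.Injective e ∧
      (∀ x : Fin m × Finset (Fin K), x ∉ Set.range e →
        ∀ i, W (e i).1 + ∑ k ∈ (e i).2, wt (e i).1 k < W x.1 + ∑ k ∈ x.2, wt x.1 k) ∧
      ∀ u : Fin r → Finset (Fin 19), Function.Injective u →
        ∃ tx : Fin m → Option (Fin K) → Fin 19 → ℂ,
          (Matrix.of fun i k : Fin r =>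
            ∏ a ∈ u i, (tx (e k).1 none a + ∑ q ∈ (e k).2, tx (e k).1 (some q) a)).det ≠ 0 :=
  universalJoinWide_coTop_poly 19 r (by norm_num) hr (by norm_num; omega)

end CoHub

end

end Summit.ValiantsHypothesis.ValiantsHypothesis.Theorems.BarrierLever.HiddenStates
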